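import Mathlib
import HarnessLib
import Summits.HubbardSuperconductivity.HubbardSuperconductivity.Theorems.KLProgrammeKLRegimeEnginePairLadderTowerComposeFwd
import Summits.HubbardSuperconductivity.HubbardSuperconductivity.Theorems.KLProgrammeKLRegimeSplitEngineV10

/-!
# Route `KLProgramme` — crux K3, ENGINE child gen 6 (stmt-HubbardSuperconductivity-20236 `KLRegimeEngineV16`), stub `stub_engine_step_values`,
# conjunct (E2-v10) at `1 ≤ n`: the forward tower composition PER PAIR CLASS with the budget left abstract, and its V10 door —
# `kltc_pairClass_compose_fwd`, `pairLadderStepAtV10_of_wickTower_fwd`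

Cell gate-hubbard-kl, seat hubbard-kl-k3c1-p1 (g7), technique «composed-map remainder propagation».  `…EnginePairLadderTowerComposeFwd`
(p496062) proved `pairLadderStepAtV9_of_wickTower_fwd`: per pair class, the straddle relations of scales `n−1` and `n` in FORWARD form plus the
Wick step compose (`kltc_tower_compose_fwd`) into ONE resummation `𝒞_n ≈ 𝒞̂_{n−1}·N₃` at the composite weight `w₁ + b − b′`, with the four-term
error `FT_{|b|}(E₂)`, and a closed-form budget hypothesis turned that into the (E2-v9) slot line.  The gen-6 slot is (E2-v10)
(`PairLadderStepAtV10`, `…SplitEngineV10`: the leg token `legDressBarQ2` replaces `legDressBarQ`, budgets LARGER).  Rather than prove V9 and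
lift (which would ask the taker for the smaller V9 budget), this file separates the two layers:

* §1 **`kltc_pairClass_compose_fwd`** — the model composition for ONE total momentum `Qm`, NO budget and NO mass clause: ball-restricted
  arrays `X, Y` (any matrices vanishing off `klBall²`), real weights `b′, w₁, b`, right inverses `M′` of `1 − diag b′·𝒞̂_{n−1}`, `N` of
  `1 + diag w₁·X`, `M₀` of `1 − diag b·𝒞̂_n`, error majorants on `klBall²` (`R′ ≤ r′`, `E_a`, `E_R ≤ e_R`, `E₁ ≥ E_a + FT_{|w₁|}(R′)`, `E₁ ≤ e₁`,
  `E₂ ≥ E_R + E₁`), smallness `m·Σ|b′| ≤ 1/3`, `((3/2)m + r′)·Σ|w₁| ≤ 1/3`, `((9/4)m + e₁ + e_R)·Σ|b| ≤ 1/3` ⟹ `∃ N₃` TWO-SIDED inverse of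
  `1 + diag(w₁ + b − b′)·𝒞̂_{n−1}` with `‖𝒞_n(Qm;k,k′) − (𝒞̂_{n−1}·N₃)(k,k′)‖ ≤ FT_{|b|}(E₂)(k,k′)` on `klBall²`;
* §2 **`pairLadderStepAtV10_of_wickTower_fwd`** — the (E2-v10) door: the same per-class data for every pair class at resolution `n`, the two mass
  clauses of the composite weight and the closed-form budget `FT_{|b|}(E₂) ≤ drivePBar + eremBar + thermalBar + legDressBarQ2·countT + (X)`
  ⟹ `PairLadderStepAtV10 … n` (`1 ≤ n`).

Exact algebra + two kernel perturbations (all in p496062 / p494435); nothing about the model's sizes is asserted.  0 kit.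
-/

noncomputable section

namespace Summit.HubbardSuperconductivity.HubbardSuperconductivity.Theorems.KLRegimeSplit

set_option linter.dupNamespace false -- summit = problem name (single-conjunct summit), D-0017

open Finset Matrix Literature.MathematicalPhysics.QuantumLattice Literature.Probability.LatticeModels
open Summit.HubbardSuperconductivity.HubbardSuperconductivity.Theorems.KLProgrammeCooperResummation
open Summit.HubbardSuperconductivity.HubbardSuperconductivity.Theorems.KLProgrammeLegKernels

section Model

variable (L M : ℕ) [NeZero L] [NeZero M]

/-! ## §1 The forward composition per pair class (no budget, no mass clause) -/

/-- **Forward tower composition for ONE pair class.**  Total momentum `Qm`, plain arrays `𝒞̂_{n−1} = klPairArray … (n−1) Qm` (`|·| ≤ m`) and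
`𝒞̂_n`; ball-restricted Wick arrays `X` (scale `n−1`), `Y` (scale `n`); real weights `b′` (straddle `n−1`), `w₁` (Wick step), `b` (straddle `n`);
right inverses `M′` of `1 − diag b′·𝒞̂_{n−1}`, `N` of `1 + diag w₁·X`, `M₀` of `1 − diag b·𝒞̂_n`; nonnegative error majorants with
`‖X − 𝒞̂_{n−1}·M′‖ ≤ R′ ≤ r′`, `‖Y − X·N‖ ≤ E_a`, `‖Y − 𝒞̂_n·M₀‖ ≤ E_R ≤ e_R` on `klBall²`, `E₁ ≥ E_a + FT_{|w₁|}(R′)`, `E₁ ≤ e₁`, `E₂ ≥ E_R + E₁`;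
smallness `m·Σ|b′| ≤ 1/3`, `((3/2)m + r′)·Σ|w₁| ≤ 1/3`, `((9/4)m + e₁ + e_R)·Σ|b| ≤ 1/3`.  THEN `1 + diag(w₁ + b − b′)·𝒞̂_{n−1}` has a two-sided
inverse `N₃` and on `klBall²`
`‖𝒞_n(Qm;k,k′) − (𝒞̂_{n−1}·N₃)(k,k′)‖ ≤ E₂(k,k′) + (3/2)(9/4 m)·Σ_t E₂(k,t)|b_t| + (3/2)((9/4)m + e₁ + e_R)·Σ_a |b_a|E₂(a,k′)
 + (9/4)((9/4)m + e₁ + e_R)(9/4 m)·Σ_aΣ_t |b_a|E₂(a,t)|b_t|`. -/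
theorem kltc_pairClass_compose_fwd {β U μ : ℝ} {K₀ : TrigPolyC4v} {n : ℕ} (Qm : TorusSite 2 L) {m : ℝ} (hm : 0 ≤ m)
    (hC₀ : ∀ s t, ‖klPairArray L M β U μ K₀ (n - 1) Qm s t‖ ≤ m)
    (X Y M' N M₀ : Matrix (TorusSite 2 L) (TorusSite 2 L) ℂ) (b' w₁ b : TorusSite 2 L → ℝ)
    (R' Ea ER E₁ E₂ : TorusSite 2 L → TorusSite 2 L → ℝ) {r' eR e₁ : ℝ} (hr' : 0 ≤ r') (heR : 0 ≤ eR) (he₁ : 0 ≤ e₁)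
    (hX0 : ∀ x y, ¬(x ∈ klBall L μ K₀ ∧ y ∈ klBall L μ K₀) → X x y = 0)
    (hY0 : ∀ x y, ¬(x ∈ klBall L μ K₀ ∧ y ∈ klBall L μ K₀) → Y x y = 0)
    (hR'0 : ∀ x y, 0 ≤ R' x y) (hEa0 : ∀ x y, 0 ≤ Ea x y) (hER0 : ∀ x y, 0 ≤ ER x y)
    (hM' : (1 - diagonal (fun p => (b' p : ℂ)) * klPairArray L M β U μ K₀ (n - 1) Qm) * M' = 1)
    (hR' : ∀ k ∈ klBall L μ K₀, ∀ k' ∈ klBall L μ K₀, ‖X k k' - (klPairArray L M β U μ K₀ (n - 1) Qm * M') k k'‖ ≤ R' k k')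
    (hR'e : ∀ x y, R' x y ≤ r')
    (hN : (1 + diagonal (fun p => (w₁ p : ℂ)) * X) * N = 1)
    (hEa : ∀ k ∈ klBall L μ K₀, ∀ k' ∈ klBall L μ K₀, ‖Y k k' - (X * N) k k'‖ ≤ Ea k k')
    (hM₀ : (1 - diagonal (fun p => (b p : ℂ)) * klPairArray L M β U μ K₀ n Qm) * M₀ = 1)
    (hER : ∀ k ∈ klBall L μ K₀, ∀ k' ∈ klBall L μ K₀, ‖Y k k' - (klPairArray L M β U μ K₀ n Qm * M₀) k k'‖ ≤ ER k k')
    (hERe : ∀ x y, ER x y ≤ eR)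
    (hE₁ : ∀ x y, Ea x y + (R' x y + 3 / 2 * (3 / 2 * m) * ∑ t, R' x t * |w₁ t| + 3 / 2 * (3 / 2 * m + r') * ∑ a, |w₁ a| * R' a y +
        9 / 4 * (3 / 2 * m + r') * (3 / 2 * m) * ∑ a, ∑ t, |w₁ a| * R' a t * |w₁ t|) ≤ E₁ x y)
    (hE₁e : ∀ x y, E₁ x y ≤ e₁) (hE₂ : ∀ x y, ER x y + E₁ x y ≤ E₂ x y)
    (hsm₀ : m * ∑ a, |b' a| ≤ 1 / 3) (hsm₁ : (3 / 2 * m + r') * ∑ a, |w₁ a| ≤ 1 / 3)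
    (hsm₂ : (9 / 4 * m + e₁ + eR) * ∑ a, |b a| ≤ 1 / 3) :
    ∃ N₃ : Matrix (TorusSite 2 L) (TorusSite 2 L) ℂ,
      (1 + diagonal (fun p => ((w₁ p + b p - b' p : ℝ) : ℂ)) * klPairArray L M β U μ K₀ (n - 1) Qm) * N₃ = 1 ∧
      N₃ * (1 + diagonal (fun p => ((w₁ p + b p - b' p : ℝ) : ℂ)) * klPairArray L M β U μ K₀ (n - 1) Qm) = 1 ∧
      ∀ k ∈ klBall L μ K₀, ∀ k' ∈ klBall L μ K₀,
        ‖klPairAmplitude L M β U μ K₀ n Qm k k' - (klPairArray L M β U μ K₀ (n - 1) Qm * N₃) k k'‖ ≤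
          E₂ k k' + 3 / 2 * (9 / 4 * m) * ∑ t, E₂ k t * |b t| + 3 / 2 * (9 / 4 * m + e₁ + eR) * ∑ a, |b a| * E₂ a k' +
            9 / 4 * (9 / 4 * m + e₁ + eR) * (9 / 4 * m) * ∑ a, ∑ t, |b a| * E₂ a t * |b t| := by
  set B := klBall L μ K₀ with hB_def
  set C₀ : Matrix (TorusSite 2 L) (TorusSite 2 L) ℂ := klPairArray L M β U μ K₀ (n - 1) Qm with hC₀_def
  set C₁ : Matrix (TorusSite 2 L) (TorusSite 2 L) ℂ := klPairArray L M β U μ K₀ n Qm with hC₁_def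
  have hC_on : ∀ j, ∀ k ∈ B, ∀ k' ∈ B, klPairArray L M β U μ K₀ j Qm k k' = klPairAmplitude L M β U μ K₀ j Qm k k' := by
    intro j k hk k' hk'
    simp only [klPairArray, Matrix.of_apply, hB_def] at hk hk' ⊢
    rw [if_pos ⟨hk, hk'⟩]
  have hC_off : ∀ j x y, ¬(x ∈ B ∧ y ∈ B) → klPairArray L M β U μ K₀ j Qm x y = 0 := by
    intro j x y hxy
    simp only [klPairArray, Matrix.of_apply, hB_def] at hxy ⊢
    rw [if_neg hxy]
  -- vanishing of the resummed arrays off the ball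
  have hM'alt : (1 + (-diagonal (fun p => (b' p : ℂ))) * C₀) * M' = 1 := by
    rw [neg_mul, ← sub_eq_add_neg]; exact hM'
  have hM₀alt : (1 + (-diagonal (fun p => (b p : ℂ))) * C₁) * M₀ = 1 := by
    rw [neg_mul, ← sub_eq_add_neg]; exact hM₀
  have hC₀M'0 : ∀ x y, ¬(x ∈ B ∧ y ∈ B) → (C₀ * M') x y = 0 := fun x y hxy =>
    kltc_mul_rightInv_apply_eq_zero C₀ _ M' B hM'alt (hC_off (n - 1)) hxy
  have hXN0 : ∀ x y, ¬(x ∈ B ∧ y ∈ B) → (X * N) x y = 0 := fun x y hxy =>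
    kltc_mul_rightInv_apply_eq_zero X _ N B hN hX0 hxy
  have hC₁M₀0 : ∀ x y, ¬(x ∈ B ∧ y ∈ B) → (C₁ * M₀) x y = 0 := fun x y hxy =>
    kltc_mul_rightInv_apply_eq_zero C₁ _ M₀ B hM₀alt (hC_off n) hxy
  -- global error bounds
  have gR' : ∀ x y, ‖X x y - (C₀ * M') x y‖ ≤ R' x y := by
    intro x y
    by_cases hxy : x ∈ B ∧ y ∈ B
    · exact hR' x hxy.1 y hxy.2
    · rw [hX0 x y hxy, hC₀M'0 x y hxy, sub_zero, norm_zero]; exact hR'0 x y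
  have gEa : ∀ x y, ‖Y x y - (X * N) x y‖ ≤ Ea x y := by
    intro x y
    by_cases hxy : x ∈ B ∧ y ∈ B
    · exact hEa x hxy.1 y hxy.2
    · rw [hY0 x y hxy, hXN0 x y hxy, sub_zero, norm_zero]; exact hEa0 x y
  have gER : ∀ x y, ‖Y x y - (C₁ * M₀) x y‖ ≤ ER x y := by
    intro x y
    by_cases hxy : x ∈ B ∧ y ∈ B
    · exact hER x hxy.1 y hxy.2
    · rw [hY0 x y hxy, hC₁M₀0 x y hxy, sub_zero, norm_zero]; exact hER0 x y
  -- norms of the real weights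
  have hτ : ∀ a, ‖(b' a : ℂ)‖ ≤ |b' a| := fun a => by rw [Complex.norm_real, Real.norm_eq_abs]
  have hρ : ∀ a, ‖(w₁ a : ℂ)‖ ≤ |w₁ a| := fun a => by rw [Complex.norm_real, Real.norm_eq_abs]
  have hσ : ∀ a, ‖(b a : ℂ)‖ ≤ |b a| := fun a => by rw [Complex.norm_real, Real.norm_eq_abs]
  obtain ⟨N₃, hN₃1, hN₃2, hbd⟩ := kltc_tower_compose_fwd C₀ C₁ X Y M' N M₀ (fun p => (b' p : ℂ)) (fun p => (w₁ p : ℂ))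
    (fun p => (b p : ℂ)) (fun a => |b' a|) (fun a => |w₁ a|) (fun a => |b a|) R' Ea ER E₁ E₂ hm hr' heR he₁ hC₀ hτ hρ hσ hM' gR'
    hR'e hN gEa hM₀ gER hERe hE₁ hE₁e hE₂ hsm₀ hsm₁ hsm₂
  have hfun : (fun p => ((w₁ p + b p - b' p : ℝ) : ℂ)) = fun a => (w₁ a : ℂ) + (b a : ℂ) - (b' a : ℂ) := by
    funext p; push_cast; ring
  refine ⟨N₃, by rw [hfun]; exact hN₃1, by rw [hfun]; exact hN₃2, fun k hk k' hk' => ?_⟩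
  have h := hbd k k'
  rw [hC₁_def, hC_on n k hk k' hk'] at h
  exact h

/-! ## §2 The (E2-v10) door -/

/-- **(E2-v10) `PairLadderStepAtV10 … n` (`1 ≤ n`) from the private Wick tower, straddle relations in FORWARD form** — the V10 twin of
`pairLadderStepAtV9_of_wickTower_fwd` (leg token `legDressBarQ2`).  Per pair class `Qm`: the data of `kltc_pairClass_compose_fwd`, the two mass
clauses of the COMPOSITE weight `w := w₁ + b − b′`, and the closed-form budget
`FT_{|b|}(E₂) ≤ drivePBar + eremBar + thermalBar + legDressBarQ2·countT + (Klam U)²·(phGain n|k−k′|_𝕋 + phGain n|k+k′−Qm|_𝕋)` at the external entries. -/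
theorem pairLadderStepAtV10_of_wickTower_fwd {G : GeoConsts} {P : SplitConsts} {Q : EngConsts} {β U μ : ℝ} {K₀ : TrigPolyC4v} {n : ℕ}
    {m : ℝ} (hn : 1 ≤ n) (hm : 0 ≤ m) (hC₀ : ∀ Qm s t, ‖klPairArray L M β U μ K₀ (n - 1) Qm s t‖ ≤ m)
    (htower : ∀ Qm : TorusSite 2 L, IsPairClassAt L Qm n →
      ∃ (X Y M' N M₀ : Matrix (TorusSite 2 L) (TorusSite 2 L) ℂ) (b' w₁ b : TorusSite 2 L → ℝ)
        (R' Ea ER E₁ E₂ : TorusSite 2 L → TorusSite 2 L → ℝ) (r' eR e₁ : ℝ),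
        0 ≤ r' ∧ 0 ≤ eR ∧ 0 ≤ e₁ ∧
        (∀ x y, ¬(x ∈ klBall L μ K₀ ∧ y ∈ klBall L μ K₀) → X x y = 0) ∧
        (∀ x y, ¬(x ∈ klBall L μ K₀ ∧ y ∈ klBall L μ K₀) → Y x y = 0) ∧
        (∀ x y, 0 ≤ R' x y) ∧ (∀ x y, 0 ≤ Ea x y) ∧ (∀ x y, 0 ≤ ER x y) ∧
        (1 - diagonal (fun p => (b' p : ℂ)) * klPairArray L M β U μ K₀ (n - 1) Qm) * M' = 1 ∧
        (∀ k ∈ klBall L μ K₀, ∀ k' ∈ klBall L μ K₀, ‖X k k' - (klPairArray L M β U μ K₀ (n - 1) Qm * M') k k'‖ ≤ R' k k') ∧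
        (∀ x y, R' x y ≤ r') ∧
        (1 + diagonal (fun p => (w₁ p : ℂ)) * X) * N = 1 ∧
        (∀ k ∈ klBall L μ K₀, ∀ k' ∈ klBall L μ K₀, ‖Y k k' - (X * N) k k'‖ ≤ Ea k k') ∧
        (1 - diagonal (fun p => (b p : ℂ)) * klPairArray L M β U μ K₀ n Qm) * M₀ = 1 ∧
        (∀ k ∈ klBall L μ K₀, ∀ k' ∈ klBall L μ K₀, ‖Y k k' - (klPairArray L M β U μ K₀ n Qm * M₀) k k'‖ ≤ ER k k') ∧
        (∀ x y, ER x y ≤ eR) ∧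
        (∀ x y, Ea x y + (R' x y + 3 / 2 * (3 / 2 * m) * ∑ t, R' x t * |w₁ t| + 3 / 2 * (3 / 2 * m + r') * ∑ a, |w₁ a| * R' a y +
            9 / 4 * (3 / 2 * m + r') * (3 / 2 * m) * ∑ a, ∑ t, |w₁ a| * R' a t * |w₁ t|) ≤ E₁ x y) ∧
        (∀ x y, E₁ x y ≤ e₁) ∧ (∀ x y, ER x y + E₁ x y ≤ E₂ x y) ∧
        m * ∑ a, |b' a| ≤ 1 / 3 ∧ (3 / 2 * m + r') * ∑ a, |w₁ a| ≤ 1 / 3 ∧ (9 / 4 * m + e₁ + eR) * ∑ a, |b a| ≤ 1 / 3 ∧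
        (∑ p, |w₁ p + b p - b' p| ≤ G.bhi) ∧
        (∑ p, (|w₁ p + b p - b' p| - (w₁ p + b p - b' p)) ≤ 2 * klEdge G n (klTorusNorm L Qm)) ∧
        (∀ k ∈ klBall L μ K₀, ∀ k' ∈ klBall L μ K₀,
          E₂ k k' + 3 / 2 * (9 / 4 * m) * ∑ t, E₂ k t * |b t| + 3 / 2 * (9 / 4 * m + e₁ + eR) * ∑ a, |b a| * E₂ a k' +
              9 / 4 * (9 / 4 * m + e₁ + eR) * (9 / 4 * m) * ∑ a, ∑ t, |b a| * E₂ a t * |b t| ≤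
            drivePBar G P U (n - 1) + eremBar G P Q U β L (n - 1) + thermalBar G P U β n +
              legDressBarQ2 G P Q U n (legSliceCountT L β μ K₀ n ![k', Qm - k', Qm - k, k]) +
              (P.Klam * U) ^ 2 * (G.phGain n (klTorusNorm L (k - k')) + G.phGain n (klTorusNorm L (k + k' - Qm))))) :
    PairLadderStepAtV10 L M G P Q β U μ K₀ n := by
  refine ⟨fun h0 => absurd h0 (by omega), fun _ Qm hQm => ?_⟩
  obtain ⟨X, Y, M', N, M₀, b', w₁, b, R', Ea, ER, E₁, E₂, r', eR, e₁, hr', heR, he₁, hX0, hY0, hR'0, hEa0, hER0, hM', hR', hR'e, hN,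
    hEa, hM₀, hER, hERe, hE₁, hE₁e, hE₂, hsm₀, hsm₁, hsm₂, hmass, hneg, hbud⟩ := htower Qm hQm
  obtain ⟨N₃, hN₃1, -, hbd⟩ := kltc_pairClass_compose_fwd L M Qm hm (hC₀ Qm) X Y M' N M₀ b' w₁ b R' Ea ER E₁ E₂ hr' heR he₁ hX0
    hY0 hR'0 hEa0 hER0 hM' hR' hR'e hN hEa hM₀ hER hERe hE₁ hE₁e hE₂ hsm₀ hsm₁ hsm₂
  exact ⟨fun p => w₁ p + b p - b' p, hmass, hneg, N₃, hN₃1, fun k hk k' hk' => (hbd k hk k' hk').trans (hbud k hk k' hk')⟩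

end Model

end Summit.HubbardSuperconductivity.HubbardSuperconductivity.Theorems.KLRegimeSplit

end
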